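import Summits.BirchSwinnertonDyer.BirchSwinnertonDyer.Theorems.ThetaPartnerAtTwoSignedKatoUpToAtTwoOffTwoRoad
import HarnessLib

/-!
# Route `ThetaPartnerAtTwo` (TP2), crux K2r0P `SignedMainConjectureCMTwoRankZeroOfPub` (stmt-BirchSwinnertonDyer-24945),
# line `rankzero` v14: the FOUR-TERM LENGTH IDENTITY of the Coleman road — the EQUALITY twin of the K3 seats'
# `SignedKatoOffTwo.fourTerm_lengthAt_le`, i.e. the algebra by which the CM port (Kato route, (P1)+(P4)) turns the K-side
# EQUALITY «ℓ_𝔭(X₀) = ℓ_𝔭(𝐇¹/Λz)» (Johnson-Leung–Kings 2011 Thm. 5.2 transported by Kato 2004 Lemma 15.13) into (MC-len)_A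

HONEST FRAMING (cell `pub/bsd-wall`, W-ALL row 1, lead prover `bsd-wall-tp2-p2` g8, 2026-08-28). MODULE THEORY ONLY over an
arbitrary commutative ring — no curve, no Selmer group, no named fact, no `sorry`; closes no item; BSD is not proved by any of this.
The K3 line (`colemanrat`) needs only the `≤` half of Kato's §17.13 length identity (Kobayashi's Thm. 7.4 proof), because Kato's
Euler-system bound 13.4 (2) is itself an inequality `ℓ_𝔭(X₀) ≤ ℓ_𝔭(𝐇¹/Λz)`. For the CM partner `A` of the crux K2r0P the global input
is an EQUALITY (the two-variable main theorem for the CM field, all primes: JLK 2011 Thm. 5.2; at `p = 2` away from the height-one prime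
`(2)` by Kato's Lemma 15.13), and the crux wants the TWO-SIDED statement (MC-len)_A «`ℓ_𝔭(X⁺) = ℓ_𝔭(Λ/(L♭))` at height-one `𝔭 ∌ 2`»
(door `SignedLengthDoors.signedUpToTwoPowerNonUnitCMTwo_exists_of_lengthEq`, file `…RankZeroLengthDoors.lean`). This file supplies the
missing algebra:
* `fourTerm_lengthAt_eq` — for `R`-linear `H →ᶜ P →ʲ X →ᵏ Y` EXACT at `P` and `X`, `c` injective, `k` SURJECTIVE, `ι : P ↪ R`, and
  any `z ∈ H`: `ℓ_𝔭(X) + ℓ_𝔭(H/Rz) + ℓ_𝔭(R/ι(P)) = ℓ_𝔭(Y) + ℓ_𝔭(R/(ι(c z)))` at EVERY prime `𝔭` — Kato's §17.13 identity with the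
  cokernel of the Coleman map kept as an explicit term (at `p = 2` `Col⁺` need not be onto; off `(2)` that term vanishes);
* `lengthAt_eq_of_fourTerm_of_eq` — hence, at a prime `𝔭` where `ℓ_𝔭(R/ι(P)) = 0`, `ℓ_𝔭(Y) = ℓ_𝔭(H/Rz) < ⊤` (the CM EQUALITY input)
  gives `ℓ_𝔭(X) = ℓ_𝔭(R/(ι(c z)))`; and `lengthAt_eq_quotient_span_of_fourTerm` — with `ℓ_𝔭(R/(ι(c z))) = ℓ_𝔭(R/(L))` (the reciprocity
  law / interpolation comparison, an identity of elements up to units and `p`-powers) this is `ℓ_𝔭(X) = ℓ_𝔭(R/(L))`, the datum-wise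
  clause of (MC-len)_A;
* (appended) `fourTerm_lengthAt_ge_of_ker_le_range`, `lengthAt_quotient_span_le_of_fourTerm` — the LOWER half (mirror of the K3
  road: complex property at `X` + deep Poitou–Tate inclusion `ker j ≤ range c` + K-side inequality in the elliptic-unit direction) giving
  the clause of (LD-len)_A, hence the REGISTERED one-sided stub;
* (appended) `lengthAt_eq_of_ker_coker_torsionBy_pow` — local lengths are invariant under maps with `π₀`-power-torsion kernel and
  cokernel at `𝔭 ∌ π₀` (the transfer by which `2`-robust data replaces exact data off `(2)`);
* `lengthAt_quotient_range_eq_zero_of_pow_mem` — the cokernel term vanishes at `𝔭 ∌ π₀` as soon as `π₀^m · R ⊆ ι(P)` (the `2`-robust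
  surjectivity of the `+` Coleman map at `2`).

References: [Kato2004Asterisque] §17.13 (p. 280), Lemma 15.13 (p. 264), Prop. 15.17; [Kobayashi2003] Thm. 7.3 (7.21) and proof of
Thm. 7.4 (p. 13); [JohnsonLeungKings2011] Thm. 5.2; [PollackRubin2004] §6–7 (the CM equality at p > 2); [Washington1997] §13.2.
-/

set_option autoImplicit false
-- the Theorems namespace of this sub repeats the summit name by design (D-0017 nested layout)
set_option linter.dupNamespace false

noncomputable section

open Literature.NumberTheory.EllipticCurves Literature.NumberTheory.EllipticCurves.Module

namespace Summit.BirchSwinnertonDyer.BirchSwinnertonDyer.Theorems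

namespace SignedLengthDoors

section FourTerm

variable {R : Type*} [CommRing R] {H P X Y : Type*} [AddCommGroup H] [_root_.Module R H]
  [AddCommGroup P] [_root_.Module R P] [AddCommGroup X] [_root_.Module R X]
  [AddCommGroup Y] [_root_.Module R Y]

/-- `ℓ_𝔭(P/c(Rz)) + ℓ_𝔭(R/ι(P)) = ℓ_𝔭(R/(ι(c z)))` for injective `ι : P → R`, any `c : H → P`, `z ∈ H`: the injection
`P/c(Rz) ↪ R/(ι c z)` of the K3 road has cokernel `R/ι(P)`. [cite: Kato2004Asterisque, §17.13 (p. 280)] -/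
theorem lengthAt_quotient_map_add_lengthAt_quotient_range (ι : P →ₗ[R] R) (hι : Function.Injective ι)
    (c : H →ₗ[R] P) (z : H) (𝔭 : PrimeSpectrum R) :
    lengthAt R (P ⧸ Submodule.map c (Submodule.span R {z})) 𝔭 + lengthAt R (R ⧸ LinearMap.range ι) 𝔭 =
      lengthAt R (R ⧸ Ideal.span {ι (c z)}) 𝔭 := by
  set M : Ideal R := Ideal.span {ι (c z)} with hM
  -- the map `ψ₀ : P → R/M`, `y ↦ [ι y]`, has kernel `c(Rz)` and range `ι(P)/M`
  let ψ₀ : P →ₗ[R] R ⧸ M := M.mkQ ∘ₗ ι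
  have hker : LinearMap.ker ψ₀ = Submodule.map c (Submodule.span R {z}) := by
    ext y
    rw [LinearMap.mem_ker, Submodule.map_span, Set.image_singleton]
    constructor
    · intro hy
      have hy' : ι y ∈ M := by
        rwa [show ψ₀ y = M.mkQ (ι y) from rfl, Submodule.mkQ_apply, Submodule.Quotient.mk_eq_zero] at hy
      rw [hM, Ideal.mem_span_singleton'] at hy'
      obtain ⟨a, ha⟩ := hy'
      have hya : y = a • c z := hι (by rw [map_smul, smul_eq_mul, ha])
      rw [hya]
      exact Submodule.smul_mem _ a (Submodule.subset_span rfl)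
    · intro hy
      rw [Submodule.mem_span_singleton] at hy
      obtain ⟨a, rfl⟩ := hy
      rw [show ψ₀ (a • c z) = M.mkQ (ι (a • c z)) from rfl, map_smul, Submodule.mkQ_apply,
        Submodule.Quotient.mk_eq_zero]
      exact M.smul_mem a (Ideal.subset_span rfl)
  have hrange : LinearMap.range ψ₀ = (LinearMap.range ι).map M.mkQ := LinearMap.range_comp _ _
  have hMle : M ≤ LinearMap.range ι := by
    rw [hM, Ideal.span_singleton_le_iff_mem]
    exact ⟨c z, rfl⟩
  -- `ℓ(R/M) = ℓ(range ψ₀) + ℓ((R/M)/range ψ₀)`, `range ψ₀ ≅ P/ker ψ₀`, `(R/M)/(ι(P)/M) ≅ R/ι(P)`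
  rw [lengthAt_eq_add_quotient (LinearMap.range ψ₀) 𝔭]
  congr 1
  · rw [← lengthAt_eq_of_linearEquiv ψ₀.quotKerEquivRange 𝔭,
      lengthAt_eq_of_linearEquiv (Submodule.quotEquivOfEq _ _ hker) 𝔭]
  · rw [lengthAt_eq_of_linearEquiv (Submodule.quotEquivOfEq _ _ hrange) 𝔭,
      lengthAt_eq_of_linearEquiv (Submodule.quotientQuotientEquivQuotient M (LinearMap.range ι) hMle) 𝔭]

/-- **The four-term IDENTITY (Kato §17.13 with the Coleman cokernel kept).** For `R`-linear `H →ᶜ P →ʲ X →ᵏ Y` EXACT at `P`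
(`ker j = range c`) and at `X` (`ker k = range j`), with `c` injective, `k` surjective, `ι : P ↪ R` injective, and any `z ∈ H`:
`ℓ_𝔭(X) + ℓ_𝔭(H/Rz) + ℓ_𝔭(R/ι(P)) = ℓ_𝔭(Y) + ℓ_𝔭(R/(ι(c z)))` at every prime `𝔭` (in `ℕ∞`, no finiteness needed).
Proof: `ℓ(X) = ℓ(P/range c) + ℓ(Y)` (exactness + surjectivity), `ℓ(P/range c) + ℓ(H/Rz) = ℓ(P/c(Rz))` (`c` injective, the K3 lemma
`SignedKatoOffTwo.lengthAt_quotient_map_eq_add`), and the previous lemma. The `≤` half, without surjectivity of `k` or of `ι`, is the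
K3 seats' `SignedKatoOffTwo.fourTerm_lengthAt_le`. [cite: Kato2004Asterisque, §17.13 (p. 280)] [cite: Kobayashi2003, proof of Thm. 7.4 (p. 13)] -/
theorem fourTerm_lengthAt_eq (ι : P →ₗ[R] R) (hι : Function.Injective ι) (c : H →ₗ[R] P)
    (hc : Function.Injective c) (j : P →ₗ[R] X) (k : X →ₗ[R] Y) (hcj : Function.Exact c j)
    (hjk : Function.Exact j k) (hk : Function.Surjective k) (z : H) (𝔭 : PrimeSpectrum R) :
    lengthAt R X 𝔭 + lengthAt R (H ⧸ Submodule.span R {z}) 𝔭 + lengthAt R (R ⧸ LinearMap.range ι) 𝔭 =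
      lengthAt R Y 𝔭 + lengthAt R (R ⧸ Ideal.span {ι (c z)}) 𝔭 := by
  -- `ℓ(X) = ℓ(range j) + ℓ(X / range j)`
  have hX : lengthAt R X 𝔭 =
      lengthAt R (LinearMap.range j) 𝔭 + lengthAt R (X ⧸ LinearMap.range j) 𝔭 :=
    lengthAt_eq_add_quotient (LinearMap.range j) 𝔭
  -- `ℓ(X / range j) = ℓ(Y)`: `X / ker k ≅ range k = Y`
  have h1 : lengthAt R (X ⧸ LinearMap.range j) 𝔭 = lengthAt R Y 𝔭 := by
    have hker : LinearMap.ker k = LinearMap.range j := LinearMap.exact_iff.mp hjk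
    rw [← lengthAt_eq_of_linearEquiv (Submodule.quotEquivOfEq _ _ hker) 𝔭,
      lengthAt_eq_of_linearEquiv k.quotKerEquivRange 𝔭,
      lengthAt_eq_of_linearEquiv (LinearEquiv.ofTop _ (LinearMap.range_eq_top.mpr hk)) 𝔭]
  -- `ℓ(range j) = ℓ(P / range c)`: `range j ≅ P / ker j = P / range c`
  have h2 : lengthAt R (LinearMap.range j) 𝔭 = lengthAt R (P ⧸ LinearMap.range c) 𝔭 := by
    have hker : LinearMap.ker j = LinearMap.range c := LinearMap.exact_iff.mp hcj
    rw [← lengthAt_eq_of_linearEquiv j.quotKerEquivRange 𝔭,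
      lengthAt_eq_of_linearEquiv (Submodule.quotEquivOfEq _ _ hker) 𝔭]
  -- `ℓ(P / range c) + ℓ(H / Rz) = ℓ(P / c(Rz))`
  have h3 : lengthAt R (P ⧸ LinearMap.range c) 𝔭 + lengthAt R (H ⧸ Submodule.span R {z}) 𝔭 =
      lengthAt R (P ⧸ Submodule.map c (Submodule.span R {z})) 𝔭 := by
    rw [SignedKatoOffTwo.lengthAt_quotient_map_eq_add c hc _ 𝔭, add_comm]
  have h4 := lengthAt_quotient_map_add_lengthAt_quotient_range ι hι c z 𝔭
  calc lengthAt R X 𝔭 + lengthAt R (H ⧸ Submodule.span R {z}) 𝔭 + lengthAt R (R ⧸ LinearMap.range ι) 𝔭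
      = lengthAt R Y 𝔭 + ((lengthAt R (P ⧸ LinearMap.range c) 𝔭 + lengthAt R (H ⧸ Submodule.span R {z}) 𝔭) +
          lengthAt R (R ⧸ LinearMap.range ι) 𝔭) := by rw [hX, h1, h2]; ring
    _ = lengthAt R Y 𝔭 + lengthAt R (R ⧸ Ideal.span {ι (c z)}) 𝔭 := by rw [h3, h4]

/-- **The CM cancellation.** In the situation of `fourTerm_lengthAt_eq`, at a prime `𝔭` where the Coleman cokernel is invisible
(`ℓ_𝔭(R/ι(P)) = 0`) and the global input is the EQUALITY `ℓ_𝔭(Y) = ℓ_𝔭(H/Rz)` with both FINITE (for the CM partner: JLK 2011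
Thm. 5.2 transported by Kato Lemma 15.13 at `𝔭 ∌ p`), one gets `ℓ_𝔭(X) = ℓ_𝔭(R/(ι(c z)))` — both divisibilities at once.
[cite: JohnsonLeungKings2011, Thm. 5.2] [cite: Kato2004Asterisque, Lemma 15.13 (p. 264) and §17.13 (p. 280)] -/
theorem lengthAt_eq_of_fourTerm_of_eq (ι : P →ₗ[R] R) (hι : Function.Injective ι) (c : H →ₗ[R] P)
    (hc : Function.Injective c) (j : P →ₗ[R] X) (k : X →ₗ[R] Y) (hcj : Function.Exact c j)
    (hjk : Function.Exact j k) (hk : Function.Surjective k) (z : H) (𝔭 : PrimeSpectrum R)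
    (hcoker : lengthAt R (R ⧸ LinearMap.range ι) 𝔭 = 0)
    (hfin : lengthAt R (H ⧸ Submodule.span R {z}) 𝔭 ≠ ⊤)
    (hglob : lengthAt R Y 𝔭 = lengthAt R (H ⧸ Submodule.span R {z}) 𝔭) :
    lengthAt R X 𝔭 = lengthAt R (R ⧸ Ideal.span {ι (c z)}) 𝔭 := by
  have h := fourTerm_lengthAt_eq ι hι c hc j k hcj hjk hk z 𝔭
  rw [hcoker, add_zero, hglob, add_comm (lengthAt R (H ⧸ Submodule.span R {z}) 𝔭)] at h
  exact WithTop.add_right_cancel hfin h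

/-- **(MC-len) datum-wise from the four-term road.** As `lengthAt_eq_of_fourTerm_of_eq`, followed by the comparison
`ℓ_𝔭(R/(ι(c z))) = ℓ_𝔭(R/(L))` of the image of the zeta class under the Coleman map with the `L`-function (for the CM partner at `2`:
Kato Prop. 15.9 / (15.12.2) + interpolation uniqueness; an identity of elements up to a unit and a power of `p`, hence of lengths off
`p`): `ℓ_𝔭(X) = ℓ_𝔭(R/(L))` — the clause of (MC-len)_A that `SignedLengthDoors.upTo_iff_lengthAt_eq_off_p` converts into the crux's
D_MC shape. [cite: Kato2004Asterisque, Prop. 15.9 (p. 258)] [cite: Kobayashi2003, Thm. 7.3 (p. 12)] -/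
theorem lengthAt_eq_quotient_span_of_fourTerm (ι : P →ₗ[R] R) (hι : Function.Injective ι) (c : H →ₗ[R] P)
    (hc : Function.Injective c) (j : P →ₗ[R] X) (k : X →ₗ[R] Y) (hcj : Function.Exact c j)
    (hjk : Function.Exact j k) (hk : Function.Surjective k) (z : H) (𝔭 : PrimeSpectrum R)
    (hcoker : lengthAt R (R ⧸ LinearMap.range ι) 𝔭 = 0)
    (hfin : lengthAt R (H ⧸ Submodule.span R {z}) 𝔭 ≠ ⊤)
    (hglob : lengthAt R Y 𝔭 = lengthAt R (H ⧸ Submodule.span R {z}) 𝔭)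
    {L : R} (hL : lengthAt R (R ⧸ Ideal.span {ι (c z)}) 𝔭 = lengthAt R (R ⧸ Ideal.span {L}) 𝔭) :
    lengthAt R X 𝔭 = lengthAt R (R ⧸ Ideal.span {L}) 𝔭 :=
  (lengthAt_eq_of_fourTerm_of_eq ι hι c hc j k hcj hjk hk z 𝔭 hcoker hfin hglob).trans hL

/-- **The Coleman cokernel is invisible off `π₀`.** If `π₀^m · R ⊆ ι(P)` (the Coleman map is onto up to a power of `π₀`; at
`p = 2` this is the `2`-robust surjectivity of `Col⁺`) then `ℓ_𝔭(R/ι(P)) = 0` at every prime `𝔭 ∌ π₀`. [folklore] -/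
theorem lengthAt_quotient_range_eq_zero_of_pow_mem (ι : P →ₗ[R] R) {π₀ : R} {m : ℕ}
    (hm : π₀ ^ m ∈ LinearMap.range ι) (𝔭 : PrimeSpectrum R) (h𝔭 : π₀ ∉ 𝔭.asIdeal) :
    lengthAt R (R ⧸ LinearMap.range ι) 𝔭 = 0 := by
  refine lengthAt_eq_zero_of_isTorsionBy (s := π₀ ^ m) ?_ 𝔭 fun h ↦ h𝔭 (𝔭.isPrime.mem_of_pow_mem m h)
  refine (Module.isTorsionBy_quotient_iff _ _).mpr fun y ↦ ?_
  rw [smul_eq_mul, mul_comm]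
  exact (LinearMap.range ι).smul_mem y hm

/-! ### Appended (same seat): the LOWER half — the mirror of the K3 road

K3's `SignedKatoOffTwo.fourTerm_lengthAt_le_of_comp_eq_zero` bounds `X` from ABOVE using only «`j ∘ c = 0`» and «`ker k ≤ range j`».
The LOWER bound on `X` uses exactly the two complementary halves — «`range j ≤ ker k`» (the complex property at `X`, formal) and
«`ker j ≤ range c`» (the DEEP half of Poitou–Tate at `P`) — together with surjectivity of `k` and the Coleman cokernel term. With the
K-side inequality in the ELLIPTIC-UNIT direction «`ℓ_𝔭(𝐇¹/Λz) ≤ ℓ_𝔭(X₀)`» (the half of JLK 2011 Thm. 5.2 that Kato's Euler-system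
bound does not give) it yields the registered one-sided stub (LD±2^k)_A through (LD-len)_A
(`SignedLengthDoors.signedLowerDivisibilityUpToTwoPowerNonUnitCMTwo_of_lengthLe`). So the CM lower half needs precisely the inputs the
non-CM K3 line does NOT: the deep Poitou–Tate inclusion and the reverse global inequality. -/

/-- **The four-term inequality, LOWER half.** For `R`-linear `H →ᶜ P →ʲ X →ᵏ Y` with `c` injective, `ι : P ↪ R` injective, `k`
surjective, the COMPLEX property at `X` (`k ∘ j = 0`) and the DEEP inclusion at `P` (`ker j ≤ range c`), and any `z ∈ H`:
`ℓ_𝔭(Y) + ℓ_𝔭(R/(ι(c z))) ≤ ℓ_𝔭(X) + ℓ_𝔭(H/Rz) + ℓ_𝔭(R/ι(P))` at every prime `𝔭`.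
[cite: Kato2004Asterisque, §17.13 (p. 280)] [cite: Kobayashi2003, (7.17)–(7.21) (pp. 12–13)] -/
theorem fourTerm_lengthAt_ge_of_ker_le_range (ι : P →ₗ[R] R) (hι : Function.Injective ι) (c : H →ₗ[R] P)
    (hc : Function.Injective c) (j : P →ₗ[R] X) (k : X →ₗ[R] Y) (hjk : ∀ x, k (j x) = 0)
    (hcj : LinearMap.ker j ≤ LinearMap.range c) (hk : Function.Surjective k) (z : H) (𝔭 : PrimeSpectrum R) :
    lengthAt R Y 𝔭 + lengthAt R (R ⧸ Ideal.span {ι (c z)}) 𝔭 ≤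
      lengthAt R X 𝔭 + lengthAt R (H ⧸ Submodule.span R {z}) 𝔭 + lengthAt R (R ⧸ LinearMap.range ι) 𝔭 := by
  -- `ℓ(X) = ℓ(range j) + ℓ(X / range j)`
  have hX : lengthAt R X 𝔭 =
      lengthAt R (LinearMap.range j) 𝔭 + lengthAt R (X ⧸ LinearMap.range j) 𝔭 :=
    lengthAt_eq_add_quotient (LinearMap.range j) 𝔭
  -- complex at `X` + `k` onto: `ℓ(Y) = ℓ(X / ker k) ≤ ℓ(X / range j)`
  have h1 : lengthAt R Y 𝔭 ≤ lengthAt R (X ⧸ LinearMap.range j) 𝔭 := by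
    have hle : LinearMap.range j ≤ LinearMap.ker k := by
      rintro _ ⟨x, rfl⟩
      exact hjk x
    have hsurj : Function.Surjective ((LinearMap.range j).mapQ (LinearMap.ker k) LinearMap.id hle) := by
      intro q
      induction q using Submodule.Quotient.induction_on with
      | H x => exact ⟨Submodule.Quotient.mk x, rfl⟩
    rw [← lengthAt_eq_of_linearEquiv (LinearEquiv.ofTop _ (LinearMap.range_eq_top.mpr hk)) 𝔭,
      ← lengthAt_eq_of_linearEquiv k.quotKerEquivRange 𝔭]
    exact lengthAt_le_of_surjective _ hsurj 𝔭
  -- deep inclusion at `P`: `ℓ(P / range c) ≤ ℓ(P / ker j) = ℓ(range j)`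
  have h2 : lengthAt R (P ⧸ LinearMap.range c) 𝔭 ≤ lengthAt R (LinearMap.range j) 𝔭 := by
    have hsurj : Function.Surjective ((LinearMap.ker j).mapQ (LinearMap.range c) LinearMap.id hcj) := by
      intro q
      induction q using Submodule.Quotient.induction_on with
      | H x => exact ⟨Submodule.Quotient.mk x, rfl⟩
    rw [← lengthAt_eq_of_linearEquiv j.quotKerEquivRange 𝔭]
    exact lengthAt_le_of_surjective _ hsurj 𝔭
  -- `ℓ(P / range c) + ℓ(H / Rz) = ℓ(P / c(Rz))` and `ℓ(P / c(Rz)) + ℓ(R / ι(P)) = ℓ(R / (ι c z))`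
  have h3 : lengthAt R (P ⧸ LinearMap.range c) 𝔭 + lengthAt R (H ⧸ Submodule.span R {z}) 𝔭 =
      lengthAt R (P ⧸ Submodule.map c (Submodule.span R {z})) 𝔭 := by
    rw [SignedKatoOffTwo.lengthAt_quotient_map_eq_add c hc _ 𝔭, add_comm]
  have h4 := lengthAt_quotient_map_add_lengthAt_quotient_range ι hι c z 𝔭
  calc lengthAt R Y 𝔭 + lengthAt R (R ⧸ Ideal.span {ι (c z)}) 𝔭
      = lengthAt R Y 𝔭 + (lengthAt R (P ⧸ LinearMap.range c) 𝔭 + lengthAt R (H ⧸ Submodule.span R {z}) 𝔭) +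
          lengthAt R (R ⧸ LinearMap.range ι) 𝔭 := by rw [← h4, ← h3]; ring
    _ ≤ lengthAt R (X ⧸ LinearMap.range j) 𝔭 +
          (lengthAt R (LinearMap.range j) 𝔭 + lengthAt R (H ⧸ Submodule.span R {z}) 𝔭) +
          lengthAt R (R ⧸ LinearMap.range ι) 𝔭 :=
        add_le_add (add_le_add h1 (add_le_add h2 le_rfl)) le_rfl
    _ = lengthAt R X 𝔭 + lengthAt R (H ⧸ Submodule.span R {z}) 𝔭 + lengthAt R (R ⧸ LinearMap.range ι) 𝔭 := by
        rw [hX]; ring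

/-- **(LD-len) datum-wise from the lower road.** In the situation of `fourTerm_lengthAt_ge_of_ker_le_range`, at a prime `𝔭` with
invisible Coleman cokernel (`ℓ_𝔭(R/ι(P)) = 0`), FINITE `ℓ_𝔭(Y)` and the K-side inequality in the elliptic-unit direction
`ℓ_𝔭(H/Rz) ≤ ℓ_𝔭(Y)`: `ℓ_𝔭(R/(ι(c z))) ≤ ℓ_𝔭(X)`; with `ℓ_𝔭(R/(ι(c z))) = ℓ_𝔭(R/(L))` this is the clause «`ℓ_𝔭(Λ/(L♭)) ≤ ℓ_𝔭(X⁺)`»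
of (LD-len)_A that `SignedLengthDoors.lowerUpTo_iff_lengthAt_le_off_p` converts into the REGISTERED stub's shape.
[cite: JohnsonLeungKings2011, Thm. 5.2] [cite: Kato2004Asterisque, Lemma 15.13 (p. 264)] [cite: Kobayashi2003, Thm. 1.3 (i) (p. 2)] -/
theorem lengthAt_quotient_span_le_of_fourTerm (ι : P →ₗ[R] R) (hι : Function.Injective ι) (c : H →ₗ[R] P)
    (hc : Function.Injective c) (j : P →ₗ[R] X) (k : X →ₗ[R] Y) (hjk : ∀ x, k (j x) = 0)
    (hcj : LinearMap.ker j ≤ LinearMap.range c) (hk : Function.Surjective k) (z : H) (𝔭 : PrimeSpectrum R)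
    (hcoker : lengthAt R (R ⧸ LinearMap.range ι) 𝔭 = 0) (hfinY : lengthAt R Y 𝔭 ≠ ⊤)
    (hglob : lengthAt R (H ⧸ Submodule.span R {z}) 𝔭 ≤ lengthAt R Y 𝔭)
    {L : R} (hL : lengthAt R (R ⧸ Ideal.span {ι (c z)}) 𝔭 = lengthAt R (R ⧸ Ideal.span {L}) 𝔭) :
    lengthAt R (R ⧸ Ideal.span {L}) 𝔭 ≤ lengthAt R X 𝔭 := by
  have h := fourTerm_lengthAt_ge_of_ker_le_range ι hι c hc j k hjk hcj hk z 𝔭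
  rw [hcoker, add_zero, hL] at h
  -- `ℓY + ℓ(R/(L)) ≤ ℓX + ℓ(H/Rz) ≤ ℓX + ℓY`; cancel the finite `ℓY`
  have h' : lengthAt R (R ⧸ Ideal.span {L}) 𝔭 + lengthAt R Y 𝔭 ≤ lengthAt R X 𝔭 + lengthAt R Y 𝔭 :=
    calc lengthAt R (R ⧸ Ideal.span {L}) 𝔭 + lengthAt R Y 𝔭
        = lengthAt R Y 𝔭 + lengthAt R (R ⧸ Ideal.span {L}) 𝔭 := add_comm _ _
      _ ≤ lengthAt R X 𝔭 + lengthAt R (H ⧸ Submodule.span R {z}) 𝔭 := h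
      _ ≤ lengthAt R X 𝔭 + lengthAt R Y 𝔭 := add_le_add le_rfl hglob
  exact (WithTop.add_le_add_iff_right hfinY).mp h'


/-! ### Appended (same seat): robust transfer of local lengths along maps with `π₀`-power-torsion kernel and cokernel

At `p = 2` the port's maps come with kernels / cokernels killed by a power of `2` (Δ-descent from `ℚ(μ_{2^∞})`, `μ₂ ⊂ 𝒪_K^×`,
the `+` Coleman map; census (T)-rows). Off `(2)` such defects are invisible: the following transfer lemma lets a port replace each
module of an honest exact four-term sequence by a `2`-isogenous one without changing any `ℓ_𝔭`, `𝔭 ∌ 2`. -/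

/-- **Local lengths are invariant under `π₀`-isogenies off `π₀`.** If `f : M → N` has kernel killed by `π₀^a` and cokernel killed by
`π₀^b`, then `ℓ_𝔭(M) = ℓ_𝔭(N)` at every prime `𝔭 ∌ π₀`. [folklore] -/
theorem lengthAt_eq_of_ker_coker_torsionBy_pow {M N : Type*} [AddCommGroup M] [_root_.Module R M] [AddCommGroup N]
    [_root_.Module R N] (f : M →ₗ[R] N) {π₀ : R} {a b : ℕ}
    (hker : ∀ m : M, f m = 0 → π₀ ^ a • m = 0) (hcoker : ∀ n : N, π₀ ^ b • n ∈ LinearMap.range f)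
    (𝔭 : PrimeSpectrum R) (h𝔭 : π₀ ∉ 𝔭.asIdeal) :
    lengthAt R M 𝔭 = lengthAt R N 𝔭 := by
  have hpa : π₀ ^ a ∉ 𝔭.asIdeal := fun h ↦ h𝔭 (𝔭.isPrime.mem_of_pow_mem a h)
  have hpb : π₀ ^ b ∉ 𝔭.asIdeal := fun h ↦ h𝔭 (𝔭.isPrime.mem_of_pow_mem b h)
  -- `ℓ(M) = ℓ(ker f) + ℓ(M / ker f) = 0 + ℓ(range f)`
  have hM : lengthAt R M 𝔭 = lengthAt R (LinearMap.range f) 𝔭 := by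
    rw [lengthAt_eq_add_quotient (LinearMap.ker f) 𝔭,
      lengthAt_eq_zero_of_isTorsionBy (M := LinearMap.ker f) (s := π₀ ^ a) (fun x ↦ by
        ext
        simpa using hker x.1 x.2) 𝔭 hpa,
      zero_add, lengthAt_eq_of_linearEquiv f.quotKerEquivRange 𝔭]
  -- `ℓ(N) = ℓ(range f) + ℓ(N / range f) = ℓ(range f) + 0`
  have hN : lengthAt R N 𝔭 = lengthAt R (LinearMap.range f) 𝔭 := by
    rw [lengthAt_eq_add_quotient (LinearMap.range f) 𝔭,
      lengthAt_eq_zero_of_isTorsionBy (M := N ⧸ LinearMap.range f) (s := π₀ ^ b)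
        ((Module.isTorsionBy_quotient_iff _ _).mpr hcoker) 𝔭 hpb, add_zero]
  rw [hM, hN]

end FourTerm

end SignedLengthDoors

end Summit.BirchSwinnertonDyer.BirchSwinnertonDyer.Theorems

end
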